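import Mathlib

/-!
# The first-order transport condition `Valid` and its soundness at the given transport

Support file for item stmt-KontsevichZagierPeriods-5830 (`CircleSquaringImpossible`, route
DefinableMoves). A transport `(s, Φ, Φ')` as in the route statement is encoded by the graph
relation `(c, x, y) ∈ G` of a `ℚ`-semialgebraic family `G ⊆ ℝ^(γ ⊕ (n ⊕ n))` at a
real parameter `c`. `Valid(λ, c)` is the conjunction of seven conditions on `(λ, c)` — functional
graph, domain inside the disc-cylinder with co-null complement, image inside the box-cylinder
`(0,λ) × (0,1) × [0,1]^M` with co-null complement, injectivity, differentiability within the domain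
with unimodular Jacobian — each written in a shape that is VISIBLY first-order over
`(ℝ, +, ·, <)` without parameters (quantifiers over real tuples, polynomial atoms; "null" replaced
by "empty interior", `HasFDerivWithinAt` by its `ε`-`δ` form in cube neighbourhoods with squared
distances). This file proves the normal-form lemmas (cube neighbourhoods, the squared `ε`-`δ` form
of `HasFDerivWithinAt`) and that the transport of the route statement satisfies `Valid(π, c₀)`
(`valid_of_transport`). No definitions are introduced: the two sets of the statement (`D × [0,1]^M`
and `(0,λ) × (0,1) × [0,1]^M`, literally as printed in the route file) and the seven clauses are
written out in full wherever they occur (the files of this proof must stay definition-free to be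
kernel-reviewed); the module docstrings name the clauses (V1)–(V7) for orientation:

* (V1) `∀ x y y', (c,x,y) ∈ G → (c,x,y') ∈ G → y = y'` (functional graph);
* (V2) `∀ x y, (c,x,y) ∈ G → x ∈ D × [0,1]^M`;
* (V3) `∀ x, ∀ r > 0, ∃ x'` in the `r`-cube at `x` with `x' ∈ D × [0,1]^M → ∃ y, (c,x',y) ∈ G`
  (the complement of the domain in the disc-cylinder has empty interior);
* (V4) `∀ x y, (c,x,y) ∈ G → y ∈ (0,λ) × (0,1) × [0,1]^M`;
* (V5) the complement of the image in the box-cylinder has empty interior (as (V3));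
* (V6) `∀ x x' y, (c,x,y) ∈ G → (c,x',y) ∈ G → x = x'` (injective);
* (V7) at every graph point `(x,y₀)` there is a matrix `L`, `det L ² = 1`, with the squared
  `ε`-`δ` differentiability condition in cubes;
* `Valid(λ, c)` = (V1) ∧ … ∧ (V7). All folklore.
-/

noncomputable section

open Set MeasureTheory Filter Topology

namespace Summit.KontsevichZagierPeriods.DefinableMoves.CircleSquaring

/-- A Lebesgue-null subset of `ℝⁿ` has empty interior (open sets have positive measure). [folklore] -/
theorem interior_eq_empty_of_volume_eq_zero {n : ℕ} {A : Set (Fin n → ℝ)} (h : volume A = 0) :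
    interior A = ∅ := by
  by_contra hne
  have hpos : 0 < volume (interior A) :=
    isOpen_interior.measure_pos volume (nonempty_iff_ne_empty.2 hne)
  have hle : volume (interior A) ≤ volume A := measure_mono interior_subset
  rw [h] at hle
  exact hpos.ne' (nonpos_iff_eq_zero.1 hle)

/-! ### Cube neighbourhoods -/

/-- The open "cube" `{x' | ∀ i, (x'ᵢ - xᵢ)² < r}` is a neighbourhood of `x` for `r > 0`. [folklore] -/
theorem cube_mem_nhds {n : ℕ} (x : Fin n → ℝ) {r : ℝ} (hr : 0 < r) :
    {x' : Fin n → ℝ | ∀ i, (x' i - x i) ^ 2 < r} ∈ 𝓝 x := by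
  refine IsOpen.mem_nhds ?_ (fun _ => by simpa using hr)
  have : {x' : Fin n → ℝ | ∀ i, (x' i - x i) ^ 2 < r} = ⋂ i, {x' | (x' i - x i) ^ 2 < r} := by
    ext; simp
  rw [this]
  exact isOpen_iInter_of_finite fun i => isOpen_lt (by fun_prop) continuous_const

/-- Points of the cube of squared radius `ε²` are `ε`-close in the sup metric. [folklore] -/
theorem dist_lt_of_cube {n : ℕ} {x x' : Fin n → ℝ} {ε : ℝ} (hε : 0 < ε)
    (h : ∀ i, (x' i - x i) ^ 2 < ε ^ 2) : dist x' x < ε := by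
  refine (dist_pi_lt_iff hε).2 fun i => ?_
  rw [Real.dist_eq]
  exact abs_lt_of_sq_lt_sq (h i) hε.le

/-- Points at sup distance `< √r` lie in the cube of squared radius `r`. [folklore] -/
theorem cube_of_dist_lt {n : ℕ} {x x' : Fin n → ℝ} {r : ℝ} (hr : 0 < r)
    (h : dist x' x < Real.sqrt r) : ∀ i, (x' i - x i) ^ 2 < r := by
  intro i
  have h1 := (dist_pi_lt_iff (Real.sqrt_pos.2 hr)).1 h i
  rw [Real.dist_eq] at h1
  have h2 : |x' i - x i| ^ 2 < r := (Real.lt_sqrt (abs_nonneg _)).1 h1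
  rwa [sq_abs] at h2

/-- **"Empty interior" in cube form (⇒).** If `interior S = ∅` then every cube around every point
contains a point outside `S`. [folklore] -/
theorem exists_cube_not_mem {n : ℕ} {S : Set (Fin n → ℝ)} (hS : interior S = ∅)
    (x : Fin n → ℝ) {r : ℝ} (hr : 0 < r) :
    ∃ x' : Fin n → ℝ, (∀ i, (x' i - x i) ^ 2 < r) ∧ x' ∉ S := by
  by_contra h
  push Not at h
  have hx : x ∈ interior S :=
    mem_interior_iff_mem_nhds.2 (mem_of_superset (cube_mem_nhds x hr) fun x' hx' => h x' hx')
  rw [hS] at hx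
  exact hx

/-- **"Empty interior" in cube form (⇐).** [folklore] -/
theorem interior_eq_empty_of_cube {n : ℕ} {S : Set (Fin n → ℝ)}
    (h : ∀ x : Fin n → ℝ, ∀ r : ℝ, 0 < r → ∃ x', (∀ i, (x' i - x i) ^ 2 < r) ∧ x' ∉ S) :
    interior S = ∅ := by
  by_contra hne
  obtain ⟨x, hx⟩ := nonempty_iff_ne_empty.2 hne
  obtain ⟨ε, hε, hball⟩ := Metric.mem_nhds_iff.1 (mem_interior_iff_mem_nhds.1 hx)
  obtain ⟨x', hx', hx'S⟩ := h x (ε ^ 2) (by positivity)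
  exact hx'S (hball (dist_lt_of_cube hε hx'))

/-! ### The squared `ε`-`δ` form of `HasFDerivWithinAt` -/

/-- In `ℝⁿ` with `n > 0` the sup norm is attained at a coordinate. [folklore] -/
theorem exists_norm_le_abs {n : ℕ} (hn : 0 < n) (v : Fin n → ℝ) : ∃ j, ‖v‖ ≤ |v j| := by
  have hne : (Finset.univ : Finset (Fin n)).Nonempty := ⟨⟨0, hn⟩, Finset.mem_univ _⟩
  obtain ⟨j, -, hj⟩ := Finset.exists_max_image Finset.univ (fun j => |v j|) hne
  exact ⟨j, (pi_norm_le_iff_of_nonneg (abs_nonneg _)).2 fun i => by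
    rw [Real.norm_eq_abs]; exact hj i (Finset.mem_univ i)⟩

/-- **`HasFDerivWithinAt` in squared `ε`-`δ` form.** For `f : ℝⁿ → ℝⁿ` (`n > 0`), `x ∈ ℝⁿ`,
`s ⊆ ℝⁿ` and a continuous linear `F`: `HasFDerivWithinAt f F s x` iff for every `e > 0` there is
`d > 0` such that for all `x' ∈ s` in the cube `∀ i, (x'ᵢ - xᵢ)² < d` one has, for every `i`, some
`j` with `(f x' - f x - F (x' - x))ᵢ² ≤ e · (x'ⱼ - xⱼ)²` (little-`o` for the sup norm, with `ε = √e`,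
`δ = √d`, the sup norm being attained at a coordinate). [folklore] -/
theorem hasFDerivWithinAt_iff_sq {n : ℕ} (hn : 0 < n) {f : (Fin n → ℝ) → (Fin n → ℝ)}
    {F : (Fin n → ℝ) →L[ℝ] (Fin n → ℝ)} {s : Set (Fin n → ℝ)} {x : Fin n → ℝ} :
    HasFDerivWithinAt f F s x ↔
      ∀ e : ℝ, 0 < e → ∃ d : ℝ, 0 < d ∧ ∀ x', x' ∈ s → (∀ i, (x' i - x i) ^ 2 < d) →
        ∀ i, ∃ j, (f x' i - f x i - F (x' - x) i) ^ 2 ≤ e * (x' j - x j) ^ 2 := by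
  rw [hasFDerivWithinAt_iff_isLittleO, Asymptotics.isLittleO_iff]
  simp only [eventually_nhdsWithin_iff, Metric.eventually_nhds_iff]
  constructor
  · intro h e he
    obtain ⟨ε, hε, hball⟩ := h (Real.sqrt_pos.2 he)
    refine ⟨ε ^ 2, by positivity, fun x' hx's hcube i => ?_⟩
    have hb := hball (dist_lt_of_cube hε hcube) hx's
    obtain ⟨j, hj⟩ := exists_norm_le_abs hn (x' - x)
    refine ⟨j, ?_⟩
    have h1 : |f x' i - f x i - F (x' - x) i| ≤ Real.sqrt e * |x' j - x j| := by
      have h2 : ‖(f x' - f x - F (x' - x)) i‖ ≤ ‖f x' - f x - F (x' - x)‖ := norm_le_pi_norm _ i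
      rw [Real.norm_eq_abs] at h2
      simp only [Pi.sub_apply] at h2 hj
      exact h2.trans (hb.trans (mul_le_mul_of_nonneg_left hj (Real.sqrt_nonneg e)))
    have h3 := pow_le_pow_left₀ (abs_nonneg _) h1 2
    rwa [sq_abs, mul_pow, Real.sq_sqrt he.le, sq_abs] at h3
  · intro h c hc
    obtain ⟨d, hd, hP⟩ := h (c ^ 2) (by positivity)
    refine ⟨Real.sqrt d, Real.sqrt_pos.2 hd, fun x' hdist hx's => ?_⟩
    have hcube : ∀ i, (x' i - x i) ^ 2 < d := cube_of_dist_lt hd hdist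
    refine (pi_norm_le_iff_of_nonneg (by positivity)).2 fun i => ?_
    obtain ⟨j, hj⟩ := hP x' hx's hcube i
    rw [Real.norm_eq_abs, Pi.sub_apply, Pi.sub_apply]
    have h1 : (f x' i - f x i - F (x' - x) i) ^ 2 ≤ (c * |x' j - x j|) ^ 2 := by
      rwa [mul_pow, sq_abs]
    have h2 := abs_le_of_sq_le_sq h1 (by positivity)
    refine h2.trans (mul_le_mul_of_nonneg_left ?_ hc.le)
    have h4 : ‖(x' - x) j‖ ≤ ‖x' - x‖ := norm_le_pi_norm _ j
    rwa [Real.norm_eq_abs, Pi.sub_apply] at h4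

/-! ### The given transport satisfies `Valid` at `λ = π` -/

/-- **Soundness at the given transport.** If `(s, Φ, Φ')` is a transport as in the route
statement `CircleSquaringImpossible` and the fibre `G_{c₀}` is the graph of `Φ` over `s`, then
`Valid(π, c₀)`. [folklore] -/
theorem valid_of_transport {γ : Type} {M : ℕ} {G : Set (γ ⊕ (Fin (2 + M) ⊕ Fin (2 + M)) → ℝ)}
    {c₀ : γ → ℝ} {s : Set (Fin (2 + M) → ℝ)} {Φ : (Fin (2 + M) → ℝ) → (Fin (2 + M) → ℝ)}
    {Φ' : (Fin (2 + M) → ℝ) → (Fin (2 + M) → ℝ) →L[ℝ] (Fin (2 + M) → ℝ)}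
    (hG : ∀ x y, Sum.elim c₀ (Sum.elim x y) ∈ G ↔ x ∈ s ∧ y = Φ x)
    (h1 : s ⊆ {z : Fin (2 + M) → ℝ | z (Fin.castAdd M 0) ^ 2 + z (Fin.castAdd M 1) ^ 2 < 1 ∧
          ∀ j : Fin M, z (Fin.natAdd 2 j) ∈ Set.Icc (0:ℝ) 1}) (h2 : volume ({z : Fin (2 + M) → ℝ | z (Fin.castAdd M 0) ^ 2 + z (Fin.castAdd M 1) ^ 2 < 1 ∧
                ∀ j : Fin M, z (Fin.natAdd 2 j) ∈ Set.Icc (0:ℝ) 1} \ s) = 0)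
    (h3 : Φ '' s ⊆ {z : Fin (2 + M) → ℝ | z (Fin.castAdd M 0) ∈ Set.Ioo 0 Real.pi ∧ z (Fin.castAdd M 1) ∈ Set.Ioo (0:ℝ) 1 ∧
          ∀ j : Fin M, z (Fin.natAdd 2 j) ∈ Set.Icc (0:ℝ) 1}) (h4 : volume ({z : Fin (2 + M) → ℝ | z (Fin.castAdd M 0) ∈ Set.Ioo 0 Real.pi ∧ z (Fin.castAdd M 1) ∈ Set.Ioo (0:ℝ) 1 ∧
                ∀ j : Fin M, z (Fin.natAdd 2 j) ∈ Set.Icc (0:ℝ) 1} \ Φ '' s) = 0)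
    (h7 : Set.InjOn Φ s) (h8 : ∀ x ∈ s, HasFDerivWithinAt Φ (Φ' x) s x)
    (h9 : ∀ x ∈ s, |(Φ' x).det| = 1) :
    ((∀ x y y' : Fin (2 + M) → ℝ, Sum.elim c₀ (Sum.elim x y) ∈ G → Sum.elim c₀ (Sum.elim x y') ∈ G →
          ∀ i, y i = y' i)) ∧
          ((∀ x y : Fin (2 + M) → ℝ, Sum.elim c₀ (Sum.elim x y) ∈ G → x ∈ {z : Fin (2 + M) → ℝ | z (Fin.castAdd M 0) ^ 2 + z (Fin.castAdd M 1) ^ 2 < 1 ∧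
                ∀ j : Fin M, z (Fin.natAdd 2 j) ∈ Set.Icc (0:ℝ) 1})) ∧
          ((∀ x : Fin (2 + M) → ℝ, ∀ r : Fin 1 → ℝ, 0 < r 0 →
                ∃ x' : Fin (2 + M) → ℝ, (∀ i, (x' i - x i) ^ 2 < r 0) ∧
                  (x' ∈ {z : Fin (2 + M) → ℝ | z (Fin.castAdd M 0) ^ 2 + z (Fin.castAdd M 1) ^ 2 < 1 ∧
                        ∀ j : Fin M, z (Fin.natAdd 2 j) ∈ Set.Icc (0:ℝ) 1} → ∃ y : Fin (2 + M) → ℝ, Sum.elim c₀ (Sum.elim x' y) ∈ G))) ∧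
          ((∀ x y : Fin (2 + M) → ℝ, Sum.elim c₀ (Sum.elim x y) ∈ G → y ∈ {z : Fin (2 + M) → ℝ | z (Fin.castAdd M 0) ∈ Set.Ioo 0 Real.pi ∧ z (Fin.castAdd M 1) ∈ Set.Ioo (0:ℝ) 1 ∧
                ∀ j : Fin M, z (Fin.natAdd 2 j) ∈ Set.Icc (0:ℝ) 1})) ∧
          ((∀ y : Fin (2 + M) → ℝ, ∀ r : Fin 1 → ℝ, 0 < r 0 →
                ∃ y' : Fin (2 + M) → ℝ, (∀ i, (y' i - y i) ^ 2 < r 0) ∧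
                  (y' ∈ {z : Fin (2 + M) → ℝ | z (Fin.castAdd M 0) ∈ Set.Ioo 0 Real.pi ∧ z (Fin.castAdd M 1) ∈ Set.Ioo (0:ℝ) 1 ∧
                        ∀ j : Fin M, z (Fin.natAdd 2 j) ∈ Set.Icc (0:ℝ) 1} → ∃ x : Fin (2 + M) → ℝ, Sum.elim c₀ (Sum.elim x y') ∈ G))) ∧
          ((∀ x x' y : Fin (2 + M) → ℝ, Sum.elim c₀ (Sum.elim x y) ∈ G → Sum.elim c₀ (Sum.elim x' y) ∈ G →
                ∀ i, x i = x' i)) ∧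
          ((∀ x y₀ : Fin (2 + M) → ℝ, Sum.elim c₀ (Sum.elim x y₀) ∈ G →
                ∃ L : Fin (2 + M) × Fin (2 + M) → ℝ, (Matrix.of fun i j => L (i, j)).det ^ 2 = 1 ∧
                  ∀ e : Fin 1 → ℝ, 0 < e 0 → ∃ d : Fin 1 → ℝ, 0 < d 0 ∧
                    ∀ x' y : Fin (2 + M) → ℝ, Sum.elim c₀ (Sum.elim x' y) ∈ G →
                      (∀ i, (x' i - x i) ^ 2 < d 0) →
                        ∀ i, ∃ j, (y i - y₀ i - ∑ k, L (i, k) * (x' k - x k)) ^ 2 ≤ e 0 * (x' j - x j) ^ 2)) := by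
  have hn : 0 < 2 + M := by omega
  refine ⟨?_, ?_, ?_, ?_, ?_, ?_, ?_⟩
  · -- (V1)
    intro x y y' hy hy' i
    rw [hG] at hy hy'
    rw [hy.2, hy'.2]
  · -- (V2)
    intro x y hy
    rw [hG] at hy
    exact h1 hy.1
  · -- (V3)
    intro x r hr
    obtain ⟨x', hx', hx'S⟩ := exists_cube_not_mem (interior_eq_empty_of_volume_eq_zero h2) x hr
    refine ⟨x', hx', fun hD => ⟨Φ x', ?_⟩⟩
    rw [hG]
    exact ⟨by_contra fun hs => hx'S ⟨hD, hs⟩, rfl⟩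
  · -- (V4)
    intro x y hy
    rw [hG] at hy
    rw [hy.2]
    exact h3 (mem_image_of_mem Φ hy.1)
  · -- (V5)
    intro y r hr
    obtain ⟨y', hy', hy'S⟩ := exists_cube_not_mem (interior_eq_empty_of_volume_eq_zero h4) y hr
    refine ⟨y', hy', fun hB => ?_⟩
    have hy'im : y' ∈ Φ '' s := by_contra fun him => hy'S ⟨hB, him⟩
    obtain ⟨x, hx, rfl⟩ := hy'im
    exact ⟨x, (hG x (Φ x)).2 ⟨hx, rfl⟩⟩
  · -- (V6)
    intro x x' y hy hy' i
    rw [hG] at hy hy'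
    rw [h7 hy.1 hy'.1 (hy.2.symm.trans hy'.2)]
  · -- (V7)
    intro x y₀ hy₀
    rw [hG] at hy₀
    obtain ⟨hx, rfl⟩ := hy₀
    set A : Matrix (Fin (2 + M)) (Fin (2 + M)) ℝ := LinearMap.toMatrix' (Φ' x : (Fin (2 + M) → ℝ) →ₗ[ℝ] (Fin (2 + M) → ℝ)) with hA
    have hAapply : ∀ v i, Φ' x v i = ∑ k, A i k * v k := by
      intro v i
      have : (Φ' x : (Fin (2 + M) → ℝ) →ₗ[ℝ] (Fin (2 + M) → ℝ)) v = Matrix.toLin' A v := by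
        rw [hA, Matrix.toLin'_toMatrix']
      rw [ContinuousLinearMap.coe_coe] at this
      rw [this, Matrix.toLin'_apply]
      rfl
    refine ⟨fun p => A p.1 p.2, ?_, ?_⟩
    · have hdet : (Matrix.of fun i j => A i j).det = (Φ' x).det := by
        have : (Matrix.of fun i j => A i j) = A := rfl
        rw [this, hA, LinearMap.det_toMatrix']
      rw [hdet, ← sq_abs, h9 x hx, one_pow]
    · intro e he
      obtain ⟨d, hd, hP⟩ := (hasFDerivWithinAt_iff_sq hn).1 (h8 x hx) (e 0) he
      refine ⟨fun _ => d, hd, fun x' y hy hcube i => ?_⟩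
      rw [hG] at hy
      obtain ⟨hx', rfl⟩ := hy
      obtain ⟨j, hj⟩ := hP x' hx' hcube i
      refine ⟨j, ?_⟩
      simpa only [hAapply, Pi.sub_apply] using hj

end Summit.KontsevichZagierPeriods.DefinableMoves.CircleSquaring
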